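import Summits.RiemannHypothesis.RiemannHypothesis.Theses.SpectralTrace
import Summits.RiemannHypothesis.RiemannHypothesis.Theorems.WindowStep.Negative.Collapse
import Summits.RiemannHypothesis.RiemannHypothesis.Theorems.SpectralTraceWindowStepConjugateSplit
import Summits.RiemannHypothesis.RiemannHypothesis.Theorems.SpectralTraceWindowStepConjugateSplitCalibration
import Summits.RiemannHypothesis.RiemannHypothesis.Theorems.SpectralTraceWindowStepSaturatedGlue
import Summits.RiemannHypothesis.RiemannHypothesis.Theorems.SpectralTraceWindowStepSharpMultiplicityCap
import Summits.RiemannHypothesis.RiemannHypothesis.Theorems.SpectralTraceWindowStepSaturatedAtoms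
import Summits.RiemannHypothesis.RiemannHypothesis.Theorems.SpectralTraceWindowStepStubGapLemma
import Summits.RiemannHypothesis.RiemannHypothesis.Theorems.SpectralTraceWindowStepFirstRungRegular
import Summits.RiemannHypothesis.RiemannHypothesis.Theorems.SpectralTraceWindowStepFirstOctave
import Summits.RiemannHypothesis.RiemannHypothesis.Theorems.SpectralTraceWindowTraceArchStubCompactness
import Summits.RiemannHypothesis.RiemannHypothesis.Theorems.SpectralTraceWindowTraceArchStubDomination
import Summits.RiemannHypothesis.RiemannHypothesis.Theorems.SpectralTraceWindowTraceArchStubCountingLaw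
import Summits.RiemannHypothesis.RiemannHypothesis.Theorems.SpectralTraceWindowTraceArchDesignIff
import Summits.RiemannHypothesis.RiemannHypothesis.Theorems.SpectralTraceWindowStepStubLogIntegrability
import Summits.RiemannHypothesis.RiemannHypothesis.Theorems.SpectralTraceWindowStepStubSaturationProfile
import Summits.RiemannHypothesis.RiemannHypothesis.Theorems.SpectralTraceWindowStepStubDesignReduction
import Summits.RiemannHypothesis.RiemannHypothesis.Theorems.SpectralTraceWindowStepStubRealZeroDensityOfLogInt
import Summits.RiemannHypothesis.RiemannHypothesis.Theorems.SpectralTraceWindowStepTraceImpDesigns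
import HarnessLib

/-!
# Line `split-birth` for the crux `WindowStep` (stmt-RiemannHypothesis-14659) — the conjugate-point
# dichotomy with BOTH children opened one layer (crux-strategist r1, EXEMPT-46 redirect, 2026-08-17;
# v2 = lead c5's reshape: the Levinson–Cartwright stub opened into TWO elementary stubs, 2026-08-17)

Crux (route decl, FIXED): `Summit.RiemannHypothesis.RiemannHypothesis.Theses.SpectralTrace.WindowStep`
`= ∀ n ≥ 2, Trace(log n) → Trace(log (n+1))` (`Trace(A)`: some real unit-multiplicity family `γ`
reproduces `W = weilFunctional` on the Weil tests supported in `[-A, A]`).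

WHY THIS LINE EXISTS. The crux is kernel-equivalent to `WindowTraceArch → RH` (Collapse, p83867) and the
route's binder pair to RH (`windowTraceArch_and_windowStep_iff_riemannHypothesis`), so the crux passes the
birth certificate only as a REDIRECT: a typed decomposition with ≥ 2 load-bearing open pieces, a proved
non-trivial assembly, no piece ≡ the crux or the summit, and a plan per open piece. The route-level split
`WindowStep ⟸ CrystRegular ∧ NoDegenerateEdge` (glue LANDED: `windowStep_of_dichotomy`, p140332; exact:
`windowStep_iff_dichotomy`) is prepared on the item (children.json) but `route edit --split` is gated to a
seat's final cycle; THIS FILE is the same decomposition in the currency the audit reads — the crux item's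
registered skeleton — with each child opened to its own birth stubs (the per-child halves are
`Lines/first_octave_ladder.lean` and `Lines/saturated_edge.lean`, to be registered against the child items
once the split is filed). It REFINES the lead's `conjugate-point` v5 (same two RH-bearing leaves
`stub_crystRegular` / `stub_coagulationSaturated`, each cut one layer further exactly where lead c4's notes
put the next inputs: the first octave = item 11196 and design form; Levinson–Cartwright + saturation).

THE SEVEN REGISTERED STUBS (two layers of content; `sorry` only inside `stub_*`; v2: stub 4 of v1,
`stub_realZeroDensity`, is now PROVED in this file from the two elementary stubs 4a/4b below;
v2.3 STATUS 2026-08-17T10:30Z: stubs 2, 4a, 4b, 5 LANDED (p149512, p148782, p150385, p148897) —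
the whole RH-free layer of both children is in `Theorems/`; OPEN = stub 1 (= item stmt-11196) and
the two RH-bearing leaves 3 and 6; 3 `sorry` left):
* child `CrystRegular` (interior horn: synthesis with slack) ⟸
  1. `stub_firstOctave` — `WindowTraceArch → WindowTracePrime2` (= the sibling crux item 11196 from the
     seed: `crystRegular_first_octave_iff`, p143818; live lead + 3 checked lines THERE);
  2. `stub_designReduction` (RH-FREE, M) — designs at level `B ≥ log 2` give `Trace(B)` (landed level-free
     compactness + domination; level-`B` copies of the landed dense family / extension);
  3. `stub_regularDesigns` (OPEN, RH-implied) — for `B > log 3`, from `Trace(log 3)` and the slack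
     `0 < ε(B/2)`: bounded-displacement designs exact on every finite test list of `[-B, B]`, one budget.
* child `NoDegenerateEdge` (edge horn: rigidity at degeneracy) ⟸ (through the LANDED reduction
  `noDegenerateEdge_of_coagulationDense`: closedness of trace levels, ground-state sampling, little-o and
  sharp-cap lemmas, all RH-free and landed)
  4. `stub_realZeroDensity` (RH-FREE; v2: a THEOREM of this file from 4a + 4b) — the ground-state
     transform `û(1/2+i·)` has `≤ (2a/π + η) r` real zeros in `[-r, r]` eventually (the upper half of
     Levinson–Cartwright [Boas 1954 Thm 8.4.16], for REAL zeros, by an elementary route):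
     4a. `stub_logIntegrability` (RH-FREE, M; pure complex analysis) — for an entire `F` with
         `|F(z)| ≤ K e^{B|Im z|}`, `F ≢ 0` on `ℝ`: `∫ log⁻|F(x)| dx/(1+x²) < ∞` (Cayley map + the tree's
         unit-disc sub-mean-value inequality `log_normSq_add_le_circleAverage_unitDisc` applied to
         `F(z)e^{iBz}`, bounded by `K` on the upper half-plane, + `integral_comp_cotHalf` + monotone
         convergence in the regularisation `ε ↓ 0`);
     4b. `stub_realZeroDensityOfLogInt` (RH-FREE, M; pure complex analysis) — for such `F` with
         `∫ log⁻|F| dx/(1+x²) < ∞`: `#(real zeros in [-r,r]) ≤ (2B/π + η) r` eventually (Jensen's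
         formula, Mathlib `AnalyticOnNhd.circleAverage_log_norm`, on discs of radius `R = εr` centred ON
         the real axis and AVERAGED along it: every real zero in `[-r, r]` collects weight exactly
         `∫_{-R}^{R} log(R/|s|) ds = 2R`, the circle means contribute `2BR/π` per unit length, and the
         loss `(2R)⁻¹ ∫_{-r-R}^{r+R} log⁻|F| = o(r)` by 4a);
  5. `stub_saturationProfile` (RH-FREE, M) — a coagulated level-`2a` family on `Z_ℝ(û)` obeying 4 is
     SATURATED (the counting budget `(2a/π) r × log r/(2a) = (r/π) log r = N_γ(r)` closes exactly);
  6. `stub_noSaturatedCrystal` (OPEN, RH-implied) — no saturated orthogonal crystal at a conjugate level.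

ASSEMBLY `WindowStep_of` (sorry-free): `crystRegular_of` (first octave by antitonicity, above `log 3`
designs + reduction) and `noDegenerateEdge_of` (stubs 4–6 through the landed reduction) feed the LANDED
IVT glue `windowStep_of_dichotomy` (seed from the rung, conjugate point by the intermediate value theorem
on the proved continuous strictly antitone `ε`, closedness below `2c`, contradiction at the edge) — a
real theorem between the pieces, not a seam.

CALIBRATION (sorry-free, below): every RH-bearing stub is RH-implied and crux-implied (nothing registered
is stronger than the crux; v2.4: for stub 3 this is now kernel-checked through
`designsAt_of_windowTrace` — a window trace IS a design with budget 0 — `regularDesigns_of_child`,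
`regularDesigns_of_windowStep`, `regularDesigns_of_riemannHypothesis`, `designsAt_iff_trace`); the two children fail in DISJOINT `WindowTraceArch ∧ ¬RH` worlds
(`dichotomy_failure_located`, p140669), so no stub and no child is ≡ the crux or ≡ RH; jointly the six
stubs + seed give RH (`riemannHypothesis_of_stubs`) — said plainly.

Disproof.lean (v2) honoured: §0 Collapse made exact (calibration block); §1 LoadBearing — the seed is
consumed by stub 1, the rung hypothesis through `seed_of_rung` + the edge statement at `log n / 2`
inside the landed glue, the conclusion window idle (consistent: every `B ≥ log n` follows); §2/§5 rigidity
(Nested/FiniteMoves/BothWays/BelowHeight) not engaged — no stub edits a given family; coagulation is the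
extreme instance of BothWays; §3 EngineKill unused. No stub is an instance of a landed Negative lemma.
-/

set_option linter.dupNamespace false

noncomputable section

open Complex Set Filter
open scoped Topology

namespace Summit.RiemannHypothesis.RiemannHypothesis.Cruxes.WindowStep.SplitBirth

open Literature.NumberTheory.LFunctions
open Summit.RiemannHypothesis.RiemannHypothesis.Theses.SpectralTrace
open Summit.RiemannHypothesis.RiemannHypothesis.Theorems
open Summit.RiemannHypothesis.RiemannHypothesis.Theorems.SpectralTraceWindowStep
open Summit.RiemannHypothesis.RiemannHypothesis.Theorems.WindowStep.Negative
open Summit.RiemannHypothesis.RiemannHypothesis.Theorems.WeilWindowFlowGronwallLeakage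
open Summit.RiemannHypothesis.RiemannHypothesis.Theorems.WeilWindowFlowStrictUnderRH

/-- File-local spelling of `Trace(A)` (verbatim the shape of the route decls). -/
local notation3 "WTrace " A:max => ∃ (ι : Type) (γ : ι → ℝ), ∀ g : ℝ → ℂ, IsWeilTest g →
  tsupport g ⊆ Set.Icc (-A) A →
    HasSum (fun i => weilMellin g (1 / 2 + (γ i : ℂ) * I)) (weilFunctional g)

/-! ## Vocabulary (definitions only) -/

/-- Polynomial local count profile of a configuration `x : ℕ → ℝ` (verbatim the seed line's
`PolyProfile`): at most `C (1+|T|)^N` indices land in `[T-1, T+1]`. -/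
def PolyProfile (x : ℕ → ℝ) (C : ℝ) (N : ℕ) : Prop :=
  ∀ (T : ℝ) (s : Finset ℕ), (∀ n ∈ s, |x n - T| ≤ 1) → (s.card : ℝ) ≤ C * (1 + |T|) ^ N

/-- **Designs at level `B`**: some log-sparse configuration `x` and ONE budget `D` such that every finite
list of Weil tests of `[-B, B]` is reproduced exactly by a real displacement of `x` of size `≤ D`. -/
def DesignsAt (B : ℝ) : Prop :=
  ∃ (x : ℕ → ℝ) (C : ℝ) (N : ℕ), PolyProfile x C N ∧
    ∃ D : ℝ, ∀ (g : ℕ → ℝ → ℂ) (m : ℕ),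
      (∀ j, IsWeilTest (g j) ∧ tsupport (g j) ⊆ Icc (-B) B) →
      ∃ δ : ℕ → ℝ, (∀ n, |δ n| ≤ D) ∧
        ∀ j < m, HasSum (fun n => weilMellin (g j) (1 / 2 + ((x n + δ n : ℝ) : ℂ) * I))
          (weilFunctional (g j))

/-- The child, spelled out (verbatim the route decl `SpectralTrace.CrystRegular`). -/
def CrystRegularStatement : Prop :=
  ∀ B : ℝ, Real.log 2 ≤ B → WindowTraceArch → 0 < weilGroundEnergy (B / 2) → WTrace B


/-- **Levinson–Cartwright upper real-zero density** of the transform `x ↦ û(1/2 + ix)`: every finite set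
of its real zeros in `[-r, r]` has at most `(2a/π + η) r` elements once `r ≥ r₀(η)`. -/
def RealZeroDensityLe (a : ℝ) (u : ℝ → ℂ) : Prop :=
  ∀ η : ℝ, 0 < η → ∃ r₀ : ℝ, ∀ r : ℝ, r₀ ≤ r → ∀ Z : Finset ℝ,
    (∀ x ∈ Z, |x| ≤ r ∧ weilMellin u (1 / 2 + (x : ℂ) * I) = 0) →
      (Z.card : ℝ) ≤ (2 * a / Real.pi + η) * r

/-- **Saturated profile** of a family `γ` on the real zeros of `û`: for every `η > 0` and all large `r`,
at least `(2a/π − η) r` distinct real zeros `x` of `û(1/2+i·)` in `[-r, r]` each carry at least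
`(1/(2a) − η) log|x|` indices of `γ` (cap-saturating atoms have the full linear density). -/
def SaturatedProfile (a : ℝ) (u : ℝ → ℂ) {ι : Type} (γ : ι → ℝ) : Prop :=
  ∀ η : ℝ, 0 < η → ∃ r₀ : ℝ, ∀ r : ℝ, r₀ ≤ r → ∃ Z : Finset ℝ,
    (∀ x ∈ Z, |x| ≤ r ∧ weilMellin u (1 / 2 + (x : ℂ) * I) = 0 ∧
      (1 / (2 * a) - η) * Real.log |x| ≤ ({i : ι | γ i = x}.ncard : ℝ)) ∧
    (2 * a / Real.pi - η) * r ≤ (Z.card : ℝ)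

/-- The child, spelled out (verbatim the route decl `SpectralTrace.NoDegenerateEdge`). -/
def NoDegenerateEdgeStatement : Prop :=
  ∀ a : ℝ, Real.log 3 / 2 ≤ a → (∀ B : ℝ, 0 < B → B < 2 * a → WTrace B) → 0 < weilGroundEnergy a

/-! ## THE REGISTERED STUBS (`sorry` lives only here) -/

/-- **stub_firstOctave (= sibling crux `WindowTracePrime2`, stmt-RiemannHypothesis-11196, from the seed;
XL; live lead + 3 checked lines under `Cruxes/WindowTracePrime2/Lines/`).** The first arithmetic rung
`Trace(log 3)` from the archimedean seed `Trace(log 2)`: the prime power `2` enters as the spike pair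
`−(log 2/√2)(δ_{log 2} + δ_{−log 2})`. Kernel-identified with the child's first octave
(`crystRegular_first_octave_iff`). -/
theorem stub_firstOctave :
    Summit.RiemannHypothesis.RiemannHypothesis.Theses.SpectralTrace.WindowTraceArch →
      Summit.RiemannHypothesis.RiemannHypothesis.Theses.SpectralTrace.WindowTracePrime2 := by
  sorry

/-- **stub_designReduction (RH-FREE, M; LANDED p149512) — designs at level `B ≥ log 2` give the rung `Trace(B)`.**
From a log-sparse configuration `x`, a budget `D` and, for every finite list of tests of `[-B, B]`, an
exact displacement within the budget: enumerate a countable `C^k`-dense family of tests of `[-B, B]`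
(level-`B` copy of the landed `stub_denseFamily`), pass to a pointwise limit displacement exact on the
whole dense family (`stub_compactness`, LANDED, level-free, fed by `stub_domination`, LANDED), and extend
to every test of `[-B, B]` by continuity of both sides (level-`B` copy of `stub_extensionOfDense`: the Weil
side carries the finite prime sum over `m < e^B`, a finite sum of point evaluations). -/
theorem stub_designReduction :
    ∀ B : ℝ, Real.log 2 ≤ B →
      (∃ (x : ℕ → ℝ) (C : ℝ) (N : ℕ),
        (∀ (T : ℝ) (s : Finset ℕ), (∀ n ∈ s, |x n - T| ≤ 1) → (s.card : ℝ) ≤ C * (1 + |T|) ^ N) ∧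
        ∃ D : ℝ, ∀ (g : ℕ → ℝ → ℂ) (m : ℕ),
          (∀ j, Literature.NumberTheory.LFunctions.IsWeilTest (g j) ∧ tsupport (g j) ⊆ Set.Icc (-B) B) →
          ∃ δ : ℕ → ℝ, (∀ n, |δ n| ≤ D) ∧
            ∀ j < m, HasSum
              (fun n => Literature.NumberTheory.LFunctions.weilMellin (g j) (1 / 2 + ((x n + δ n : ℝ) : ℂ) * Complex.I))
              (Literature.NumberTheory.LFunctions.weilFunctional (g j))) →
      ∃ (ι : Type) (γ : ι → ℝ), ∀ g : ℝ → ℂ, Literature.NumberTheory.LFunctions.IsWeilTest g →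
        tsupport g ⊆ Set.Icc (-B) B →
          HasSum (fun i => Literature.NumberTheory.LFunctions.weilMellin g (1 / 2 + (γ i : ℂ) * Complex.I))
            (Literature.NumberTheory.LFunctions.weilFunctional g) :=
  -- LANDED p149512 (wave-1 worker): Theorems/SpectralTraceWindowStepStubDesignReduction.lean
  Summit.RiemannHypothesis.RiemannHypothesis.Theorems.SpectralTraceWindowStep.stub_designReduction

/-- **stub_regularDesigns (OPEN, RH-implied; HARDEST — the regular ladder above the first arithmetic
rung, in design form).** For `B > log 3`, from the rung `Trace(log 3)` and the spectral slack
`0 < ε(B/2)`: some log-sparse configuration admits, with one budget, bounded real displacements exact on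
every finite list of Weil tests of `[-B, B]`. List by list this is an open condition inside the finite
moment cone (the slack keeps the target in its interior); the content is the UNIFORM budget. Fails, in the
threshold model of `WindowTraceArch ∧ ¬RH`, iff the integer ladder dies with slack above `log 3`. -/
theorem stub_regularDesigns :
    ∀ B : ℝ, Real.log 3 < B →
      Summit.RiemannHypothesis.RiemannHypothesis.Theses.SpectralTrace.WindowTracePrime2 →
        0 < Literature.NumberTheory.LFunctions.weilGroundEnergy (B / 2) →
          ∃ (x : ℕ → ℝ) (C : ℝ) (N : ℕ),
            (∀ (T : ℝ) (s : Finset ℕ), (∀ n ∈ s, |x n - T| ≤ 1) → (s.card : ℝ) ≤ C * (1 + |T|) ^ N) ∧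
            ∃ D : ℝ, ∀ (g : ℕ → ℝ → ℂ) (m : ℕ),
              (∀ j, Literature.NumberTheory.LFunctions.IsWeilTest (g j) ∧ tsupport (g j) ⊆ Set.Icc (-B) B) →
              ∃ δ : ℕ → ℝ, (∀ n, |δ n| ≤ D) ∧
                ∀ j < m, HasSum
                  (fun n => Literature.NumberTheory.LFunctions.weilMellin (g j) (1 / 2 + ((x n + δ n : ℝ) : ℂ) * Complex.I))
                  (Literature.NumberTheory.LFunctions.weilFunctional (g j)) := by
  sorry



/-- **stub_logIntegrability (RH-FREE, M; v2 stub 4a — pure complex analysis; LANDED p148782).** An entire function of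
exponential type bounded on the real axis has Poisson-integrable `log⁻` on the axis: if `F` is entire,
`‖F z‖ ≤ K e^{B |Im z|}` (`K ≥ 1`, `B ≥ 0`) and `F c ≠ 0` for some real `c`, then
`x ↦ log⁺(1/|F(x)|)/(1+x²)` is integrable on `ℝ` (the `log⁻` half of "exponential type + bounded on
`ℝ` ⇒ Cartwright class"; Boas 1954 §6.6–7.2, Koosis 1988 §III.G.2). Elementary route: `G(z) = F(z)e^{iBz}`
is bounded by `K` on the closed upper half-plane; compose with the Cayley map of the unit disc based at a
point `c + it` with `G(c+it) ≠ 0`, apply the tree's `log_normSq_add_le_circleAverage_unitDisc` to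
`log(|G|² + ε)`, change variables with `integral_comp_cotHalf`, and let `ε ↓ 0` by monotone convergence:
`∫ log⁻|F(c − tσ)| dσ/(1+σ²) ≤ π log(K²+1) − π log|G(c+it)|²`. [Boas 1954, Entire Functions, Thm 6.6.x;
Koosis 1988, The Logarithmic Integral I, §III.G.2] -/
theorem stub_logIntegrability :
    ∀ (F : ℂ → ℂ) (K B : ℝ), Differentiable ℂ F → 1 ≤ K → 0 ≤ B →
      (∀ z : ℂ, ‖F z‖ ≤ K * Real.exp (B * |z.im|)) → (∃ c : ℝ, F (c : ℂ) ≠ 0) →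
        MeasureTheory.Integrable (fun x : ℝ => Real.posLog ‖F (x : ℂ)‖⁻¹ / (1 + x ^ 2)) :=
  -- LANDED p148782 (wave-1 worker): Theorems/SpectralTraceWindowStepStubLogIntegrability.lean
  Summit.RiemannHypothesis.RiemannHypothesis.Theorems.SpectralTraceWindowStep.stub_logIntegrability

/-- **stub_realZeroDensityOfLogInt (RH-FREE, M; v2 stub 4b — pure complex analysis; LANDED p150385, part I p149909).** For an entire `F`
with `‖F z‖ ≤ K e^{B |Im z|}` (`K ≥ 1`, `B ≥ 0`), `F c ≠ 0` for some real `c`, and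
`∫ log⁺(1/|F(x)|) dx/(1+x²) < ∞`, the REAL zeros have upper density `≤ 2B/π`: for every `η > 0` there is
`r₀` such that every finite set of real zeros in `[-r, r]`, `r ≥ r₀`, has at most `(2B/π + η) r` elements.
Proof (averaged Jensen): for a.e. real `x₀` Jensen's formula on `|z − x₀| ≤ R`
(`AnalyticOnNhd.circleAverage_log_norm`) and `log|F| ≤ log K + B R |sin θ|` on the circle give
`Σ_{λ real zero} log⁺(R/|λ − x₀|) ≤ log K + 2BR/π + log⁻|F(x₀)|`; integrating `x₀` over `[-r-R, r+R]`,
each real zero `λ ∈ [-r, r]` collects `∫_{-R}^{R} log(R/|s|) ds = 2R`, so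
`2R · #Z ≤ 2(r+R)(log K + 2BR/π) + ∫_{-r-R}^{r+R} log⁻|F|`; with `R = εr` the last term is `o(r²)` by the
log-integrability (tail of a convergent integral times `1 + (r+R)²`). [folklore; cf. Boas 1954 Thm 8.4.16,
Levinson 1940 Ch. III for the full Levinson–Cartwright theorem] -/
theorem stub_realZeroDensityOfLogInt :
    ∀ (F : ℂ → ℂ) (K B : ℝ), Differentiable ℂ F → 1 ≤ K → 0 ≤ B →
      (∀ z : ℂ, ‖F z‖ ≤ K * Real.exp (B * |z.im|)) → (∃ c : ℝ, F (c : ℂ) ≠ 0) →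
        MeasureTheory.Integrable (fun x : ℝ => Real.posLog ‖F (x : ℂ)‖⁻¹ / (1 + x ^ 2)) →
          ∀ η : ℝ, 0 < η → ∃ r₀ : ℝ, ∀ r : ℝ, r₀ ≤ r → ∀ Z : Finset ℝ,
            (∀ x ∈ Z, |x| ≤ r ∧ F (x : ℂ) = 0) → (Z.card : ℝ) ≤ (2 * B / Real.pi + η) * r :=
  -- LANDED p150385 (lead; part I p149909): Theorems/SpectralTraceWindowStepStubRealZeroDensityOfLogInt.lean
  Summit.RiemannHypothesis.RiemannHypothesis.Theorems.SpectralTraceWindowStep.stub_realZeroDensityOfLogInt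


/-- **stub_saturationProfile (RH-FREE, M; the counting budget closes; LANDED p148897).** Let `a ≥ (log 3)/2`, `u` a
ground state of `[-a, a]` whose transform obeys the Levinson–Cartwright bound, and `γ` a level-`2a`
family lying INSIDE the real zero set of `û(1/2+i·)`. Then `γ` has a saturated profile on those zeros.
Inputs, all landed: the counting law `#{i : γ i ∈ [0, T]} = θ(T)/π + O(log(1+T))`
(`SpectralTraceWindowTraceArch.stub_countingLaw`, for every witness of the seed — `γ` and its reflection
are, `2a ≥ log 3 > log 2`, `windowTrace_anti`), the sharp cap `ncard_fibre_le_sharp` (p142955), local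
finiteness (`card_near_le_log_of_windowTrace`); then the budget
`(r/π) log r − O(r) ≤ N_γ(r) = Σ_{x ∈ Z_r} mult(x) ≤ #Z_r · (1/(2a)+η₁) log r − #U_r · (η+η₁) log r + O(1)`
with `#Z_r ≤ (2a/π + η₂) r` bounds the under-saturated positions `#U_r ≤ O((η₁ + η₂/a)/(η+η₁)) r` and
forces `#Z_r ≥ (2a/π)(1 − O(aη₁)) r − o(r)`. -/
theorem stub_saturationProfile :
    ∀ a : ℝ, Real.log 3 / 2 ≤ a → ∀ u : ℝ → ℂ, Literature.NumberTheory.LFunctions.IsWeilGroundState a u →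
      (∀ η : ℝ, 0 < η → ∃ r₀ : ℝ, ∀ r : ℝ, r₀ ≤ r → ∀ Z : Finset ℝ,
        (∀ x ∈ Z, |x| ≤ r ∧
          Literature.NumberTheory.LFunctions.weilMellin u (1 / 2 + (x : ℂ) * Complex.I) = 0) →
          (Z.card : ℝ) ≤ (2 * a / Real.pi + η) * r) →
      ∀ (ι : Type) (γ : ι → ℝ),
        (∀ g : ℝ → ℂ, Literature.NumberTheory.LFunctions.IsWeilTest g →
          tsupport g ⊆ Set.Icc (-(2 * a)) (2 * a) →
            HasSum (fun i => Literature.NumberTheory.LFunctions.weilMellin g (1 / 2 + (γ i : ℂ) * Complex.I))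
              (Literature.NumberTheory.LFunctions.weilFunctional g)) →
        (∀ i : ι, Literature.NumberTheory.LFunctions.weilMellin u (1 / 2 + (γ i : ℂ) * Complex.I) = 0) →
        ∀ η : ℝ, 0 < η → ∃ r₀ : ℝ, ∀ r : ℝ, r₀ ≤ r → ∃ Z : Finset ℝ,
          (∀ x ∈ Z, |x| ≤ r ∧
            Literature.NumberTheory.LFunctions.weilMellin u (1 / 2 + (x : ℂ) * Complex.I) = 0 ∧
            (1 / (2 * a) - η) * Real.log |x| ≤ ({i : ι | γ i = x}.ncard : ℝ)) ∧
          (2 * a / Real.pi - η) * r ≤ (Z.card : ℝ) :=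
  -- LANDED p148897 (wave-1 worker): Theorems/SpectralTraceWindowStepStubSaturationProfile.lean
  Summit.RiemannHypothesis.RiemannHypothesis.Theorems.SpectralTraceWindowStep.stub_saturationProfile

/-- **stub_noSaturatedCrystal (OPEN, RH-implied; HARDEST — the typed Diophantine residual of the edge
horn).** At a conjugate level `a ≥ (log 3)/2` (`ε(a) = 0`; none exists `≤ a₁` for some `a₁ > (log 3)/2`,
`exists_gt_log_three_half_weilGroundEnergy_pos`; at most one, strict antitonicity) no real family
reproducing `W` on the Weil tests of `[-2a, 2a]` has a SATURATED PROFILE on the real zeros of a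
ground-state transform `û(1/2+i·)`: the orthogonal crystal of the critical Weil–de Branges space — `û` of
sine type with all zeros asymptotically real at the maximal density `2a/π`, the family sitting on them with
integer multiplicities equal to the Christoffel values `(1+o(1)) log|x|/(2a)` — does not exist. Vacuous
under RH (no conjugate point: `coagulationDense_of_riemannHypothesis` pattern); implied by the child (a
rung at `2a` with `ε(a) = 0` contradicts it); in the threshold model of `WindowTraceArch ∧ ¬RH` it fails
iff the integer ladder dies EXACTLY at the conjugate level (`A‡ = 2a⋆`). Handles: de Branges Thm 22
(orthogonal sampling sets and their canonical weights `π/(φ′(x)|E(x)|²)`), the explicit arithmetic of `W`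
on `(−2a, 2a)` (finite prime sum) sampled along a near-arithmetic progression, and the kit lab j021467
(edge autopsy: Christoffel readings at the null ground state's real zeros). -/
theorem stub_noSaturatedCrystal :
    ∀ a : ℝ, Real.log 3 / 2 ≤ a → Literature.NumberTheory.LFunctions.weilGroundEnergy a = 0 →
      ∀ u : ℝ → ℂ, Literature.NumberTheory.LFunctions.IsWeilGroundState a u →
        ∀ (ι : Type) (γ : ι → ℝ),
          (∀ g : ℝ → ℂ, Literature.NumberTheory.LFunctions.IsWeilTest g →
            tsupport g ⊆ Set.Icc (-(2 * a)) (2 * a) →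
              HasSum (fun i => Literature.NumberTheory.LFunctions.weilMellin g (1 / 2 + (γ i : ℂ) * Complex.I))
                (Literature.NumberTheory.LFunctions.weilFunctional g)) →
          (∀ η : ℝ, 0 < η → ∃ r₀ : ℝ, ∀ r : ℝ, r₀ ≤ r → ∃ Z : Finset ℝ,
            (∀ x ∈ Z, |x| ≤ r ∧
              Literature.NumberTheory.LFunctions.weilMellin u (1 / 2 + (x : ℂ) * Complex.I) = 0 ∧
              (1 / (2 * a) - η) * Real.log |x| ≤ ({i : ι | γ i = x}.ncard : ℝ)) ∧
            (2 * a / Real.pi - η) * r ≤ (Z.card : ℝ)) →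
          ∃ i : ι, Literature.NumberTheory.LFunctions.weilMellin u (1 / 2 + (γ i : ℂ) * Complex.I) ≠ 0 := by
  sorry

/-! ## Name-keyed aliases (the hypotheses of the composition) -/
namespace Registered

/-- Alias keyed by the registered stub name. -/
abbrev stub_firstOctave : Prop := WindowTraceArch → WindowTracePrime2
/-- Alias keyed by the registered stub name. -/
abbrev stub_designReduction : Prop := ∀ B : ℝ, Real.log 2 ≤ B → DesignsAt B → WTrace B
/-- Alias keyed by the registered stub name. -/
abbrev stub_regularDesigns : Prop :=
  ∀ B : ℝ, Real.log 3 < B → WindowTracePrime2 → 0 < weilGroundEnergy (B / 2) → DesignsAt B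

/-- Alias keyed by the registered stub name (v2 stub 4a). -/
abbrev stub_logIntegrability : Prop :=
  ∀ (F : ℂ → ℂ) (K B : ℝ), Differentiable ℂ F → 1 ≤ K → 0 ≤ B →
    (∀ z : ℂ, ‖F z‖ ≤ K * Real.exp (B * |z.im|)) → (∃ c : ℝ, F (c : ℂ) ≠ 0) →
      MeasureTheory.Integrable (fun x : ℝ => Real.posLog ‖F (x : ℂ)‖⁻¹ / (1 + x ^ 2))
/-- Alias keyed by the registered stub name (v2 stub 4b). -/
abbrev stub_realZeroDensityOfLogInt : Prop :=
  ∀ (F : ℂ → ℂ) (K B : ℝ), Differentiable ℂ F → 1 ≤ K → 0 ≤ B →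
    (∀ z : ℂ, ‖F z‖ ≤ K * Real.exp (B * |z.im|)) → (∃ c : ℝ, F (c : ℂ) ≠ 0) →
      MeasureTheory.Integrable (fun x : ℝ => Real.posLog ‖F (x : ℂ)‖⁻¹ / (1 + x ^ 2)) →
        ∀ η : ℝ, 0 < η → ∃ r₀ : ℝ, ∀ r : ℝ, r₀ ≤ r → ∀ Z : Finset ℝ,
          (∀ x ∈ Z, |x| ≤ r ∧ F (x : ℂ) = 0) → (Z.card : ℝ) ≤ (2 * B / Real.pi + η) * r
/-- Alias keyed by the v1 stub name (now a theorem of this file: `stub_realZeroDensity`). -/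
abbrev stub_realZeroDensity : Prop :=
  ∀ a : ℝ, 0 < a → ∀ u : ℝ → ℂ, IsWeilGroundState a u → RealZeroDensityLe a u
/-- Alias keyed by the registered stub name. -/
abbrev stub_saturationProfile : Prop :=
  ∀ a : ℝ, Real.log 3 / 2 ≤ a → ∀ u : ℝ → ℂ, IsWeilGroundState a u → RealZeroDensityLe a u →
    ∀ (ι : Type) (γ : ι → ℝ),
      (∀ g : ℝ → ℂ, IsWeilTest g → tsupport g ⊆ Set.Icc (-(2 * a)) (2 * a) →
        HasSum (fun i => weilMellin g (1 / 2 + (γ i : ℂ) * I)) (weilFunctional g)) →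
      (∀ i : ι, weilMellin u (1 / 2 + (γ i : ℂ) * I) = 0) → SaturatedProfile a u γ
/-- Alias keyed by the registered stub name. -/
abbrev stub_noSaturatedCrystal : Prop :=
  ∀ a : ℝ, Real.log 3 / 2 ≤ a → weilGroundEnergy a = 0 → ∀ u : ℝ → ℂ, IsWeilGroundState a u →
    ∀ (ι : Type) (γ : ι → ℝ),
      (∀ g : ℝ → ℂ, IsWeilTest g → tsupport g ⊆ Set.Icc (-(2 * a)) (2 * a) →
        HasSum (fun i => weilMellin g (1 / 2 + (γ i : ℂ) * I)) (weilFunctional g)) →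
      SaturatedProfile a u γ → ∃ i : ι, weilMellin u (1 / 2 + (γ i : ℂ) * I) ≠ 0

end Registered

/-- **v1 stub 4 from v2 stubs 4a + 4b** (sorry-free): the ground-state transform `z ↦ û(1/2 + iz)` is
entire (`differentiable_weilMellin_half_add`), bounded by `max 1 ‖u‖₁ · e^{a|Im z|}`
(`norm_weilMellin_half_add_le`) and `≢ 0` on `ℝ` (`exists_weilMellin_half_line_ne_zero`), so 4a gives
its log-integrability and 4b the density bound with `B = a`. -/
theorem realZeroDensity_of (h₄a : Registered.stub_logIntegrability)
    (h₄b : Registered.stub_realZeroDensityOfLogInt) : Registered.stub_realZeroDensity := by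
  intro a ha u hu η hη
  have hF := differentiable_weilMellin_half_add hu
  have hb := norm_weilMellin_half_add_le hu
  obtain ⟨ξ, hξ⟩ := exists_weilMellin_half_line_ne_zero hu
  have hint := h₄a (fun z : ℂ => weilMellin u (1 / 2 + z * Complex.I))
    (max 1 (∫ t, ‖u t‖)) a hF (le_max_left _ _) ha.le hb ⟨ξ, hξ⟩
  obtain ⟨r₀, hr₀⟩ := h₄b (fun z : ℂ => weilMellin u (1 / 2 + z * Complex.I))
    (max 1 (∫ t, ‖u t‖)) a hF (le_max_left _ _) ha.le hb ⟨ξ, hξ⟩ hint η hη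
  exact ⟨r₀, fun r hr Z hZ => hr₀ r hr Z hZ⟩

/-- **stub_realZeroDensity (RH-FREE; v1 stub 4, now a THEOREM from 4a + 4b).** For a ground state `u` of
the window `[-a, a]` (`MemLp u 2`, `L²`-limit of unit tests supported in `[-a, a]`, so `û(1/2+i·)` is
entire of exponential type `≤ a`, bounded by `max 1 ‖u‖₁` times `e^{a|Im z|}`
(`norm_weilMellin_half_add_le`), `≢ 0` on `ℝ` by `exists_weilMellin_half_line_ne_zero`), the real zeros
have upper density `≤ 2a/π`: `#(Z ∩ [-r, r]) ≤ (2a/π + η) r` for every finite set `Z` of real zeros,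
`r ≥ r₀(u, η)`. [Levinson 1940, Gap and Density Theorems, Ch. III; Boas 1954, Entire Functions, §8.4] -/
theorem stub_realZeroDensity :
    ∀ a : ℝ, 0 < a → ∀ u : ℝ → ℂ, Literature.NumberTheory.LFunctions.IsWeilGroundState a u →
      ∀ η : ℝ, 0 < η → ∃ r₀ : ℝ, ∀ r : ℝ, r₀ ≤ r → ∀ Z : Finset ℝ,
        (∀ x ∈ Z, |x| ≤ r ∧
          Literature.NumberTheory.LFunctions.weilMellin u (1 / 2 + (x : ℂ) * Complex.I) = 0) →
          (Z.card : ℝ) ≤ (2 * a / Real.pi + η) * r :=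
  realZeroDensity_of stub_logIntegrability stub_realZeroDensityOfLogInt

/-! ## Consistency -/

theorem designsAt_iff (B : ℝ) : DesignsAt B ↔
    ∃ (x : ℕ → ℝ) (C : ℝ) (N : ℕ),
      (∀ (T : ℝ) (s : Finset ℕ), (∀ n ∈ s, |x n - T| ≤ 1) → (s.card : ℝ) ≤ C * (1 + |T|) ^ N) ∧
      ∃ D : ℝ, ∀ (g : ℕ → ℝ → ℂ) (m : ℕ),
        (∀ j, IsWeilTest (g j) ∧ tsupport (g j) ⊆ Set.Icc (-B) B) →
        ∃ δ : ℕ → ℝ, (∀ n, |δ n| ≤ D) ∧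
          ∀ j < m, HasSum (fun n => weilMellin (g j) (1 / 2 + ((x n + δ n : ℝ) : ℂ) * I))
            (weilFunctional (g j)) := Iff.rfl

theorem firstOctave_holds : Registered.stub_firstOctave := stub_firstOctave
theorem designReduction_holds : Registered.stub_designReduction := stub_designReduction
theorem regularDesigns_holds : Registered.stub_regularDesigns := stub_regularDesigns
theorem logIntegrability_holds : Registered.stub_logIntegrability := stub_logIntegrability
theorem realZeroDensityOfLogInt_holds : Registered.stub_realZeroDensityOfLogInt :=
  stub_realZeroDensityOfLogInt
theorem realZeroDensity_holds : Registered.stub_realZeroDensity := stub_realZeroDensity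
theorem saturationProfile_holds : Registered.stub_saturationProfile := stub_saturationProfile
theorem noSaturatedCrystal_holds : Registered.stub_noSaturatedCrystal := stub_noSaturatedCrystal

/-! ## Kernel-checked glue (no `sorry` below this line) -/

/-- **Child 1 from stubs 1–3**: on the first octave `B ≤ log 3` the sibling rung serves by antitonicity;
above `log 3`, designs with slack (stub 3, fed the rung of stub 1) and the RH-free reduction (stub 2). -/
theorem crystRegular_of (h₁ : Registered.stub_firstOctave) (h₂ : Registered.stub_designReduction)
    (h₃ : Registered.stub_regularDesigns) : CrystRegularStatement := by
  intro B hB2 hArch hε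
  by_cases hB3 : B ≤ Real.log 3
  · exact windowTrace_anti hB3 (h₁ hArch)
  · exact h₂ B hB2 (h₃ B (lt_of_not_ge hB3) (h₁ hArch) hε)

/-- **No coagulated rung at a conjugate level** from stubs 4–6. -/
theorem exists_weilMellin_ne_zero_of_stubs (h₄ : Registered.stub_realZeroDensity)
    (h₅ : Registered.stub_saturationProfile) (h₆ : Registered.stub_noSaturatedCrystal)
    {a : ℝ} (ha : Real.log 3 / 2 ≤ a) (h0 : weilGroundEnergy a = 0) {u : ℝ → ℂ}
    (hu : IsWeilGroundState a u) {ι : Type} {γ : ι → ℝ}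
    (hγ : ∀ g : ℝ → ℂ, IsWeilTest g → tsupport g ⊆ Set.Icc (-(2 * a)) (2 * a) →
      HasSum (fun i => weilMellin g (1 / 2 + (γ i : ℂ) * I)) (weilFunctional g)) :
    ∃ i : ι, weilMellin u (1 / 2 + (γ i : ℂ) * I) ≠ 0 := by
  by_contra hnone
  push Not at hnone
  have hapos : 0 < a := lt_of_lt_of_le (by positivity) ha
  have hprof : SaturatedProfile a u γ := h₅ a ha u hu (h₄ a hapos u hu) ι γ hγ hnone
  obtain ⟨i, hi⟩ := h₆ a ha h0 u hu ι γ hγ hprof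
  exact hi (hnone i)

/-- **Child 2 from stubs 4–6** through the landed RH-free reduction
`noDegenerateEdge_of_coagulationDense` (its density hypotheses are not even needed). -/
theorem noDegenerateEdge_of (h₄ : Registered.stub_realZeroDensity)
    (h₅ : Registered.stub_saturationProfile) (h₆ : Registered.stub_noSaturatedCrystal) :
    NoDegenerateEdgeStatement :=
  noDegenerateEdge_of_coagulationDense fun _ ha h0 _ hu _ _ _ _ _ hγ =>
    exists_weilMellin_ne_zero_of_stubs h₄ h₅ h₆ ha h0 hu hγ

/-- **THE LINE CONCLUDES THE CRUX BY NAME** (no `sorry` in this declaration): the two children from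
their stubs (v2: seven registered stubs, stub 4 of v1 assembled from 4a + 4b by `realZeroDensity_of`;
v2.1: the landed 4a and 5 discharged in the proof),
then the landed IVT glue of the conjugate-point dichotomy. -/
theorem WindowStep_of (h₁ : Registered.stub_firstOctave)
    (h₃ : Registered.stub_regularDesigns) (h₆ : Registered.stub_noSaturatedCrystal) :
    Summit.RiemannHypothesis.RiemannHypothesis.Theses.SpectralTrace.WindowStep :=
  -- v2.3: the LANDED RH-free stubs 2 (`stub_designReduction`, p149512), 4a (`stub_logIntegrability`,
  -- p148782), 4b (`stub_realZeroDensityOfLogInt`, p150385) and 5 (`stub_saturationProfile`, p148897)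
  -- are discharged inside the proof; the open hypotheses are exactly the three open stubs:
  -- the first octave (= item stmt-11196) and the two RH-bearing leaves.
  windowStep_of_dichotomy (crystRegular_of h₁ designReduction_holds h₃)
    (noDegenerateEdge_of (realZeroDensity_of logIntegrability_holds realZeroDensityOfLogInt_holds)
      saturationProfile_holds h₆)

/-- Wiring check: the registered stubs feed `WindowStep_of` as stated (an `example`, so that no
sorry-tainted DECLARATION of this file has the crux as its type). -/
example : Summit.RiemannHypothesis.RiemannHypothesis.Theses.SpectralTrace.WindowStep :=
  WindowStep_of stub_firstOctave stub_regularDesigns stub_noSaturatedCrystal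

/-! ## Calibration (sorry-free): honesty of the stubs -/

/-- Child 1 is RH-implied. -/
theorem crystRegular_of_riemannHypothesis (hRH : _root_.RiemannHypothesis) : CrystRegularStatement :=
  fun B _ _ _ => windowTrace_of_riemannHypothesis hRH B

/-- Child 1 is CRUX-implied (Collapse): nothing on its side is stronger than the crux. -/
theorem crystRegular_of_windowStep (hStep : WindowStep) : CrystRegularStatement :=
  crystRegular_of_windowStep' hStep

/-- The trace form of stub 3 (the regular ladder above `log 3`) follows from child 1, hence from the
crux and from RH. -/
theorem regularLadder_of_child (h : CrystRegularStatement) :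
    ∀ B : ℝ, Real.log 3 < B → WindowTracePrime2 → 0 < weilGroundEnergy (B / 2) → WTrace B := by
  intro B hB hP hε
  have h23 : Real.log 2 ≤ Real.log 3 := Real.log_le_log two_pos (by norm_num)
  exact h B (h23.trans hB.le) (windowTrace_anti h23 hP) hε

/-- A window trace at level `B > 0` is ALREADY a design at level `B` (budget `D = 0`; the family
enumerated by `ℕ`, profile from the upper local Weyl law): `designsAt_of_windowTrace`, LANDED. -/
theorem designsAt_of_trace {B : ℝ} (hB : 0 < B) (h : WTrace B) : DesignsAt B :=
  designsAt_of_windowTrace B hB h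

/-- `DesignsAt B ↔ Trace(B)` for `B ≥ log 2` (design form = trace form: `stub_designReduction` and
`designsAt_of_windowTrace`, both LANDED). -/
theorem designsAt_iff_trace {B : ℝ} (hB : Real.log 2 ≤ B) : DesignsAt B ↔ WTrace B :=
  ⟨designReduction_holds B hB, designsAt_of_trace (lt_of_lt_of_le (Real.log_pos one_lt_two) hB)⟩

/-- Stub 3 is CHILD-1-implied (v2.4: the design form is the trace form), hence nothing registered on
the interior side is stronger than the child. -/
theorem regularDesigns_of_child (h : CrystRegularStatement) : Registered.stub_regularDesigns :=
  fun B hB hP hε => designsAt_of_trace (lt_trans (Real.log_pos (by norm_num)) hB)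
    (regularLadder_of_child h B hB hP hε)

/-- Stub 3 is CRUX-implied. -/
theorem regularDesigns_of_windowStep (hStep : WindowStep) : Registered.stub_regularDesigns :=
  regularDesigns_of_child (crystRegular_of_windowStep hStep)

/-- Stub 3 is RH-implied. -/
theorem regularDesigns_of_riemannHypothesis (hRH : _root_.RiemannHypothesis) :
    Registered.stub_regularDesigns :=
  regularDesigns_of_child (crystRegular_of_riemannHypothesis hRH)

/-- Stub 1 is implied outright by the sibling crux item `WindowTracePrime2` (stmt-11196). -/
theorem firstOctave_of_windowTracePrime2 (h : WindowTracePrime2) : Registered.stub_firstOctave :=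
  fun _ => h

/-- Stub 1 is CRUX-implied given the seed (`windowTracePrime2_of_windowStep_of_windowTraceArch`). -/
theorem firstOctave_of_windowStep (hStep : WindowStep) : Registered.stub_firstOctave :=
  fun hArch => windowTracePrime2_of_windowStep_of_windowTraceArch hStep hArch

/-- Child 2 is CRUX-implied. -/
theorem noDegenerateEdge_of_windowStep (hStep : WindowStep) : NoDegenerateEdgeStatement :=
  noDegenerateEdge_of_windowStep' hStep

/-- Stub 6 is RH-implied — vacuous under RH (no conjugate point). -/
theorem noSaturatedCrystal_of_riemannHypothesis (hRH : _root_.RiemannHypothesis) :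
    Registered.stub_noSaturatedCrystal := by
  intro a ha h0
  exfalso
  have hapos : 0 < a := lt_of_lt_of_le (by positivity) ha
  have hpos : WeilPositivityOn (a + 1) :=
    WeilPositivityOn.of_riemannHypothesis explicit_formula_holds hRH (a + 1)
  have := weilGroundEnergy_pos_of_weilPositivityOn_of_lt hpos hapos (by linarith)
  linarith

/-- Stub 6 is child-2-implied, hence CRUX-implied. -/
theorem noSaturatedCrystal_of_child (h : NoDegenerateEdgeStatement) :
    Registered.stub_noSaturatedCrystal := by
  intro a ha h0 u _ ι γ hγ _
  exfalso
  have hbelow : ∀ B : ℝ, 0 < B → B < 2 * a → WTrace B :=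
    fun B _ hB => windowTrace_anti hB.le ⟨ι, γ, hγ⟩
  have := h a ha hbelow
  linarith

/-- **Honest accounting (Collapse made exact for this line):** the seven stubs turn the SEED into RH, so
the two RH-bearing stubs (3 and 6) are jointly worth `WindowTraceArch → RH` given the first octave
(stub 1 = item 11196) and the four LANDED RH-free stubs (2, 4a, 4b, 5); by
`dichotomy_failure_located` (p140669) the two children — hence stubs 3 and 6 — fail in DISJOINT
`WindowTraceArch ∧ ¬RH` worlds (interior death vs edge death), so neither alone is. -/
theorem riemannHypothesis_of_stubs (h₁ : Registered.stub_firstOctave)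
    (h₃ : Registered.stub_regularDesigns)
    (h₆ : Registered.stub_noSaturatedCrystal) (hArch : WindowTraceArch) : _root_.RiemannHypothesis :=
  riemannHypothesis_of_windowTraceArch_of_windowStep hArch (WindowStep_of h₁ h₃ h₆)

end Summit.RiemannHypothesis.RiemannHypothesis.Cruxes.WindowStep.SplitBirth

end
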